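import Mathlib.CategoryTheory.Equivalence
import Mathlib.CategoryTheory.Endomorphism
import Mathlib.CategoryTheory.Functor.FullyFaithful
import Mathlib.Topology.Algebra.Group.Basic
import Mathlib.Topology.Homeomorph.Lemmas
import Literature.AlgebraicGeometry.Frobenioids.ProfiniteUnits
import Literature.AlgebraicGeometry.Frobenioids.PreFrobenioidDataOfFunctor
import HarnessLib

/-!
# Frobenioids I: transport of units, base-identity endomorphisms and Frobenius-trivial objects along
# an equivalence lying over the base (tools for [FrdI] Cor. 5.7, "sorting through the definitions")

Mochizuki, *The geometry of Frobenioids I: the general theory*, Kyushu J. Math. **62** (2008)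
293–400, kurims text: Def. 1.2 (ii)/(iv) pp. 21–23, Def. 2.8 (i) p. 52, Cor. 4.11 (ii) p. 91, Cor. 5.7 and
its proof p. 108 ll. 15–21 [cite: MochizukiFrdI2008, Cor. 5.7 p.108]: "sorting through the definitions,
to verify assertions (i), (ii), (iii), (iv) it suffices to show that `Ψ` preserves isotropic objects,
prime-Frobenius morphisms, pull-back morphisms, birationalizations, the natural projection functor
`C_i → D_i` [hence, in particular, the units `O^×(−)`], and … Frobenius degrees."

PROOF-ONLY file (no new definitions). For pre-Frobenioids `F_i : C_i ⥤ F_{Φ_i}` (the cell's Def. 1.1–1.2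
files) and an equivalence `Ψ : C₁ ⥲ C₂` LYING OVER a functor `Ψ^Base : D₁ → D₂` — i.e. together with a
`1`-commutative square `η : Base₂ ∘ Ψ ≅ Ψ^Base ∘ Base₁`, the conclusion of [FrdI] Thm. 3.4 (v) /
Cor. 4.11 (ii) — we prove the elementary transport facts that the printed proof of Cor. 5.7 uses:

* `Ψ` preserves and reflects base-identity endomorphisms (`Ψ^Base` faithful); hence maps `O^×(A)`
  isomorphically onto `O^×(Ψ A)` (`unitsSubgroup_map_equivalence_of_square`); conjugation by an
  isomorphism `A ≅ B` identifies `O^×(A)` and `O^×(B)`;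
* "admits a topologically finitely generated profinite topology" (Def. 2.8 (i)) is invariant under group
  isomorphisms, so the unit-profinite condition transfers along `Ψ`
  (`forall_admitsTfgProfiniteTopology_units_iff_of_square`);
* `Ψ` maps Frobenius-trivial objects to Frobenius-trivial objects, given that it preserves morphisms of
  Frobenius type and acts on Frobenius degrees through an automorphism `Ψ^{N_{≥1}}` of `N_{≥1}`
  (Thm. 3.4 (iii)): transport `ζ` as `Ψ ∘ ζ ∘ (Ψ^{N_{≥1}})⁻¹`;
* group-like objects are invariant under isomorphism; conjugation by `eqToHom` preserves Frobenius
  degree, base-identity and Frobenius type; the interface rendering of "pull-back morphism"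
  (`PreFrobenioidData.IsPullbackMorphism (ofFunctor Φ F)`) agrees with Def. 1.2 (ii)'s
  (`PreFrobenioid.IsPullbackMorphism F`).

Nothing here is specific to the abc programme; no statement of the paper is strengthened.
-/

namespace Literature.AlgebraicGeometry.Frobenioids

open CategoryTheory Opposite Topology

universe w v v' u u'

/-! ### Transport of "admits a topologically finitely generated profinite topology" -/

section Transport

variable {M : Type*} [Group M] {N : Type*} [Group N]

/-- "Admits a topologically finitely generated profinite topology" (FrdI Def. 2.8 (i) p. 52) is
invariant under isomorphisms of groups: transport the topology along the isomorphism.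
[cite: MochizukiFrdI2008, Def. 2.8(i) p.52] -/
theorem AdmitsTfgProfiniteTopology.of_mulEquiv (e : M ≃* N) (h : AdmitsTfgProfiniteTopology M) :
    AdmitsTfgProfiniteTopology N := by
  obtain ⟨t, ht⟩ := h
  letI : TopologicalSpace M := t
  letI tN : TopologicalSpace N := TopologicalSpace.induced e.symm t
  have hind : IsInducing (e.symm : N → M) := ⟨rfl⟩
  haveI := ht.isTopologicalGroup
  haveI := ht.compactSpace
  haveI := ht.t2Space
  haveI := ht.totallyDisconnectedSpace
  -- `e` as a homeomorphism `M ≃ₜ N`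
  let ψ : N ≃ₜ M := e.symm.toEquiv.toHomeomorphOfIsInducing hind
  refine ⟨tN, ⟨?_, ?_, ?_, ?_, ?_⟩⟩
  · exact hind.topologicalGroup (e.symm : N →* M)
  · exact ψ.symm.compactSpace
  · exact ψ.symm.t2Space
  · exact ψ.symm.totallyDisconnectedSpace
  · obtain ⟨S, hS⟩ := ht.exists_finset_dense
    classical
    refine ⟨S.image e, ?_⟩
    have hc : (Subgroup.closure ((S.image e : Finset N) : Set N) : Set N) =
        ψ.symm '' (Subgroup.closure (S : Set M) : Set M) := by
      have h1 : Subgroup.closure ((S.image e : Finset N) : Set N) =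
          (Subgroup.closure (S : Set M)).map (e : M →* N) := by
        rw [MonoidHom.map_closure, Finset.coe_image]
        rfl
      rw [h1, Subgroup.coe_map]
      rfl
    rw [hc]
    exact ψ.symm.surjective.denseRange.dense_image ψ.symm.continuous hS

end Transport

/-! ### The two renderings of "pull-back morphism" agree -/

namespace PreFrobenioidData

variable {D : Type u} [Category.{v} D] {Φ : Dᵒᵖ ⥤ CommMonCat.{w}} {C : Type u'} [Category.{v'} C]
  (F : C ⥤ ElemFrobenioid Φ)

/-- Pull-back morphism: the interface rendering (unique lifting of pairs `(χ, β)`) agrees with the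
definition file's (bijectivity of `γ ↦ (φ ∘ γ, Base γ)`) (FrdI Def. 1.2 (ii) p. 21).
[cite: MochizukiFrdI2008, Def. 1.2 (ii) p.21] -/
theorem ofFunctor_isPullbackMorphism {A B : C} (φ : A ⟶ B) :
    (ofFunctor Φ F).IsPullbackMorphism φ ↔ PreFrobenioid.IsPullbackMorphism F φ := by
  constructor
  · intro h X
    rw [Function.bijective_iff_existsUnique]
    rintro ⟨⟨χ, β⟩, hχβ⟩
    obtain ⟨ψ, ⟨h1, h2⟩, huniq⟩ := h χ β hχβ.symm
    refine ⟨ψ, Subtype.ext (Prod.ext h1 h2), fun ψ' hψ' => huniq ψ' ⟨?_, ?_⟩⟩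
    · exact congrArg (fun p => p.1.1) hψ'
    · exact congrArg (fun p => p.1.2) hψ'
  · intro h X χ β hβ
    obtain ⟨ψ, h1, h2⟩ := (Function.bijective_iff_existsUnique _).mp (h X) ⟨(χ, β), hβ.symm⟩
    refine ⟨ψ, ⟨congrArg (fun p => p.1.1) h1, congrArg (fun p => p.1.2) h1⟩, fun ψ' hψ' => h2 ψ' ?_⟩
    exact Subtype.ext (Prod.ext hψ'.1 hψ'.2)

end PreFrobenioidData

namespace PreFrobenioid

/-! ### Units `O^×(-)` along isomorphisms of one pre-Frobenioid -/

section OnePreFrobenioid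

variable {D : Type u} [Category.{v} D] {Φ : Dᵒᵖ ⥤ CommMonCat.{w}}
  {C : Type u'} [Category.{v'} C] (F : C ⥤ ElemFrobenioid Φ)

/-- Both directions of an isomorphism of `C` have Frobenius degree `1` (their degrees multiply to
`deg_Fr(id) = 1` in `N_{≥1}`). [cite: MochizukiFrdI2008, Rem. 1.1.1 p.21] -/
theorem degFr_iso_hom {A B : C} (e : A ≅ B) : degFr F e.hom = 1 := by
  have h : degFr F e.hom * degFr F e.inv = 1 := by rw [← degFr_comp, e.hom_inv_id, degFr_id]
  have h' := congrArg PNat.val h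
  rw [PNat.mul_coe, PNat.one_coe] at h'
  exact PNat.coe_inj.mp ((Nat.eq_one_of_mul_eq_one_right h').trans PNat.one_coe.symm)

/-- Conjugation by an isomorphism `e : A ≅ B` of `C` (`u ↦ e⁻¹ u e`) carries `O^×(A)` into `O^×(B)`:
`Base(e⁻¹ u e) = Base(e)⁻¹ Base(e) = id`. [cite: MochizukiFrdI2008, Def. 1.2 (ii) p.22] -/
theorem autMulEquivOfIso_mem_unitsSubgroup {A B : C} (e : A ≅ B) {u : Aut A} (hu : u ∈ unitsSubgroup F A) :
    Aut.autMulEquivOfIso e u ∈ unitsSubgroup F B := by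
  refine ⟨?_, ?_⟩
  · show Base F (e.inv ≫ u.hom ≫ e.hom) = 𝟙 _
    rw [base_comp, base_comp, hu.1, Category.id_comp, ← base_comp, e.inv_hom_id, base_id]
  · show degFr F (e.inv ≫ u.hom ≫ e.hom) = 1
    rw [degFr_comp, degFr_comp, hu.2, one_mul, ← degFr_comp, e.inv_hom_id, degFr_id]

/-- `O^×(B)` is the image of `O^×(A)` under conjugation by `e : A ≅ B`.
[cite: MochizukiFrdI2008, Def. 1.2 (ii) p.22] -/
theorem unitsSubgroup_map_autMulEquivOfIso {A B : C} (e : A ≅ B) :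
    (unitsSubgroup F A).map (Aut.autMulEquivOfIso e : Aut A →* Aut B) = unitsSubgroup F B := by
  ext v
  constructor
  · rintro ⟨u, hu, rfl⟩
    exact autMulEquivOfIso_mem_unitsSubgroup F e hu
  · intro hv
    refine ⟨(Aut.autMulEquivOfIso e).symm v, ?_, MulEquiv.apply_symm_apply _ _⟩
    have h := autMulEquivOfIso_mem_unitsSubgroup F e.symm hv
    -- the two descriptions of conjugation by `e⁻¹` agree
    have heq : (Aut.autMulEquivOfIso e).symm v = Aut.autMulEquivOfIso e.symm v := by
      apply Aut.ext
      rfl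
    rw [heq]
    exact h

/-- Isomorphic objects have isomorphic unit groups `O^×(-)`. [cite: MochizukiFrdI2008, Def. 1.2 (ii) p.22] -/
theorem nonempty_unitsSubgroup_mulEquiv_of_iso {A B : C} (e : A ≅ B) :
    Nonempty (unitsSubgroup F A ≃* unitsSubgroup F B) :=
  ⟨((Aut.autMulEquivOfIso e).subgroupMap (unitsSubgroup F A)).trans
    (MulEquiv.subgroupCongr (unitsSubgroup_map_autMulEquivOfIso F e))⟩

end OnePreFrobenioid

/-! ### Units along an equivalence lying over a `1`-commutative square of base categories -/

section TwoPreFrobenioids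

variable {D₁ : Type u} [Category.{v} D₁] {Φ₁ : D₁ᵒᵖ ⥤ CommMonCat.{w}}
  {C₁ : Type u'} [Category.{v'} C₁] (F₁ : C₁ ⥤ ElemFrobenioid Φ₁)
  {D₂ : Type u} [Category.{v} D₂] {Φ₂ : D₂ᵒᵖ ⥤ CommMonCat.{w}}
  {C₂ : Type u'} [Category.{v'} C₂] (F₂ : C₂ ⥤ ElemFrobenioid Φ₂)

/-- If `Ψ : C₁ ⥲ C₂` lies over a functor `Ψ^Base : D₁ → D₂` that is faithful (e.g. an equivalence),
i.e. `Base₂ ∘ Ψ ≅ Ψ^Base ∘ Base₁` (the `1`-commutative square of FrdI Thm. 3.4 (v) / Cor. 4.11 (ii)),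
then `Ψ` preserves and reflects base-identity endomorphisms. [cite: MochizukiFrdI2008, Cor. 4.11 (ii) p.91] -/
theorem isBaseIdentity_map_iff_of_square (Ψ : C₁ ≌ C₂) (ΨBase : D₁ ⥤ D₂) [ΨBase.Faithful]
    (η : Ψ.functor ⋙ baseFunctor F₂ ≅ baseFunctor F₁ ⋙ ΨBase) {A : C₁} (α : A ⟶ A) :
    IsBaseIdentity F₂ (Ψ.functor.map α) ↔ IsBaseIdentity F₁ α := by
  have nat := η.hom.naturality α
  constructor
  · intro h
    have h' : (Ψ.functor ⋙ baseFunctor F₂).map α = 𝟙 _ := h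
    rw [h', Category.id_comp] at nat
    -- `η_A = η_A ≫ Ψ^Base(Base α)`, so `Ψ^Base(Base α) = id`
    have hY : (baseFunctor F₁ ⋙ ΨBase).map α = 𝟙 _ :=
      calc (baseFunctor F₁ ⋙ ΨBase).map α
          = (η.inv.app A ≫ η.hom.app A) ≫ (baseFunctor F₁ ⋙ ΨBase).map α := by
            rw [Iso.inv_hom_id_app, Category.id_comp]
        _ = η.inv.app A ≫ (η.hom.app A ≫ (baseFunctor F₁ ⋙ ΨBase).map α) := Category.assoc _ _ _
        _ = η.inv.app A ≫ η.hom.app A := by rw [← nat]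
        _ = 𝟙 _ := Iso.inv_hom_id_app η A
    exact ΨBase.map_injective (hY.trans (ΨBase.map_id _).symm)
  · intro h
    have hY : (baseFunctor F₁ ⋙ ΨBase).map α = 𝟙 _ := by
      show ΨBase.map ((baseFunctor F₁).map α) = _
      rw [show (baseFunctor F₁).map α = 𝟙 _ from h, ΨBase.map_id]
      rfl
    rw [hY, Category.comp_id] at nat
    -- `Base(Ψ α) ≫ η_A = η_A`, so `Base(Ψ α) = id`
    show (Ψ.functor ⋙ baseFunctor F₂).map α = 𝟙 _
    calc (Ψ.functor ⋙ baseFunctor F₂).map α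
        = (Ψ.functor ⋙ baseFunctor F₂).map α ≫ (η.hom.app A ≫ η.inv.app A) := by
          rw [Iso.hom_inv_id_app, Category.comp_id]
      _ = ((Ψ.functor ⋙ baseFunctor F₂).map α ≫ η.hom.app A) ≫ η.inv.app A := (Category.assoc _ _ _).symm
      _ = η.hom.app A ≫ η.inv.app A := by rw [nat]
      _ = 𝟙 _ := Iso.hom_inv_id_app η A

/-- Under the same square, `Ψ` induces `O^×(A) ⥲ O^×(Ψ A)`: the image of `O^×(A)` under
`Aut(A) ⥲ Aut(Ψ A)` is `O^×(Ψ A)`. [cite: MochizukiFrdI2008, Cor. 5.7 (ii) p.108] -/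
theorem unitsSubgroup_map_equivalence_of_square (Ψ : C₁ ≌ C₂) (ΨBase : D₁ ⥤ D₂) [ΨBase.Faithful]
    (η : Ψ.functor ⋙ baseFunctor F₂ ≅ baseFunctor F₁ ⋙ ΨBase) (A : C₁) :
    (unitsSubgroup F₁ A).map
        (Ψ.fullyFaithfulFunctor.autMulEquivOfFullyFaithful A : Aut A →* Aut (Ψ.functor.obj A)) =
      unitsSubgroup F₂ (Ψ.functor.obj A) := by
  have he : ∀ a : Aut A, Ψ.fullyFaithfulFunctor.autMulEquivOfFullyFaithful A a = Ψ.functor.mapIso a :=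
    fun a => rfl
  ext β
  constructor
  · rintro ⟨α, hα, rfl⟩
    refine ⟨?_, ?_⟩
    · show IsBaseIdentity F₂ (Ψ.fullyFaithfulFunctor.autMulEquivOfFullyFaithful A α).hom
      rw [he]
      exact (isBaseIdentity_map_iff_of_square F₁ F₂ Ψ ΨBase η α.hom).mpr hα.1
    · exact degFr_iso_hom F₂ _
  · intro hβ
    refine ⟨(Ψ.fullyFaithfulFunctor.autMulEquivOfFullyFaithful A).symm β, ⟨?_, degFr_iso_hom F₁ _⟩,
      MulEquiv.apply_symm_apply _ _⟩
    have h1 : IsBaseIdentity F₂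
        (Ψ.functor.mapIso ((Ψ.fullyFaithfulFunctor.autMulEquivOfFullyFaithful A).symm β)).hom := by
      rw [← he, MulEquiv.apply_symm_apply]
      exact hβ.1
    exact (isBaseIdentity_map_iff_of_square F₁ F₂ Ψ ΨBase η _).mp h1

/-- Under the same square, `O^×(A) ≅ O^×(Ψ A)` as groups. [cite: MochizukiFrdI2008, Cor. 5.7 (ii) p.108] -/
theorem nonempty_unitsSubgroup_mulEquiv_of_square (Ψ : C₁ ≌ C₂) (ΨBase : D₁ ⥤ D₂) [ΨBase.Faithful]
    (η : Ψ.functor ⋙ baseFunctor F₂ ≅ baseFunctor F₁ ⋙ ΨBase) (A : C₁) :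
    Nonempty (unitsSubgroup F₁ A ≃* unitsSubgroup F₂ (Ψ.functor.obj A)) :=
  ⟨((Ψ.fullyFaithfulFunctor.autMulEquivOfFullyFaithful A).subgroupMap (unitsSubgroup F₁ A)).trans
    (MulEquiv.subgroupCongr (unitsSubgroup_map_equivalence_of_square F₁ F₂ Ψ ΨBase η A))⟩

/-- **Corollary 5.7 (ii), the transport step** in unfolded form: if `Ψ : C₁ ⥲ C₂` lies over a faithful
`Ψ^Base : D₁ → D₂`, then every `O^×(A₁)`, `A₁ ∈ Ob(C₁)`, admits a topologically finitely generated profinite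
topology iff every `O^×(A₂)`, `A₂ ∈ Ob(C₂)`, does ("`Ψ` preserves … the units `O^×(−)`", FrdI p. 108).
[cite: MochizukiFrdI2008, Cor. 5.7 (ii) p.108] -/
theorem forall_admitsTfgProfiniteTopology_units_iff_of_square (Ψ : C₁ ≌ C₂) (ΨBase : D₁ ⥤ D₂)
    [ΨBase.Faithful] (η : Ψ.functor ⋙ baseFunctor F₂ ≅ baseFunctor F₁ ⋙ ΨBase) :
    (∀ A : C₁, AdmitsTfgProfiniteTopology (unitsSubgroup F₁ A)) ↔
      ∀ B : C₂, AdmitsTfgProfiniteTopology (unitsSubgroup F₂ B) := by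
  constructor
  · intro h B
    obtain ⟨e₁⟩ := nonempty_unitsSubgroup_mulEquiv_of_square F₁ F₂ Ψ ΨBase η (Ψ.inverse.obj B)
    obtain ⟨e₂⟩ := nonempty_unitsSubgroup_mulEquiv_of_iso F₂ (Ψ.counitIso.app B)
    exact AdmitsTfgProfiniteTopology.of_mulEquiv (e₁.trans e₂) (h _)
  · intro h A
    obtain ⟨e₁⟩ := nonempty_unitsSubgroup_mulEquiv_of_square F₁ F₂ Ψ ΨBase η A
    exact AdmitsTfgProfiniteTopology.of_mulEquiv e₁.symm (h _)

/-- Over the `1`-commutative square `η : Base₂ ∘ Ψ ≅ Ψ^Base ∘ Base₁`, `Base₂(Ψ f)` is the conjugate of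
`Ψ^Base(Base₁ f)` by `η` (stated with the composite functors, so that all objects are literally
`(Ψ ⋙ Base₂)(A)`, `(Base₁ ⋙ Ψ^Base)(A)`). [cite: MochizukiFrdI2008, Cor. 4.11 (ii) p.91] -/
theorem comp_base_map_eq_conj (Ψ : C₁ ≌ C₂) (ΨBase : D₁ ⥤ D₂)
    (η : Ψ.functor ⋙ baseFunctor F₂ ≅ baseFunctor F₁ ⋙ ΨBase) {A A' : C₁} (f : A ⟶ A') :
    (Ψ.functor ⋙ baseFunctor F₂).map f = η.hom.app A ≫ (baseFunctor F₁ ⋙ ΨBase).map f ≫ η.inv.app A' := by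
  rw [← Category.assoc, ← η.hom.naturality f, Category.assoc, Iso.hom_inv_id_app, Category.comp_id]

/-- `Ψ` maps Frobenius-trivial objects to Frobenius-trivial objects, provided it preserves morphisms of
Frobenius type, acts on Frobenius degrees through an automorphism `Ψ^{N_{≥1}}` of `N_{≥1}` (Thm. 3.4
(iii)) and lies over a faithful `Ψ^Base` (so that base-identity endomorphisms are preserved): transport
the section `ζ : N_{≥1} → End(A)` as `Ψ ∘ ζ ∘ (Ψ^{N_{≥1}})⁻¹`. [cite: MochizukiFrdI2008, Cor. 5.7 (i) p.108] -/
theorem isFrobeniusTrivial_map_of_square (Ψ : C₁ ≌ C₂) (ΨBase : D₁ ⥤ D₂) [ΨBase.Faithful]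
    (η : Ψ.functor ⋙ baseFunctor F₂ ≅ baseFunctor F₁ ⋙ ΨBase)
    (hft : PreFrobenioidData.PreservesMor Ψ.functor (PreFrobenioidData.ofFunctor Φ₁ F₁).IsFrobeniusType
      (PreFrobenioidData.ofFunctor Φ₂ F₂).IsFrobeniusType)
    (ΨN : ℕ+ ≃* ℕ+) (hN : ∀ ⦃A B : C₁⦄ (φ : A ⟶ B), degFr F₂ (Ψ.functor.map φ) = ΨN (degFr F₁ φ))
    {A : C₁} (hA : IsFrobeniusTrivial F₁ A) : IsFrobeniusTrivial F₂ (Ψ.functor.obj A) := by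
  obtain ⟨ζ, hζ⟩ := hA
  refine ⟨(Functor.mapEnd A Ψ.functor).comp (ζ.comp ΨN.symm.toMonoidHom), fun n => ⟨?_, ?_, ?_⟩⟩
  · show degFr F₂ (Ψ.functor.map (ζ (ΨN.symm n))) = n
    rw [hN, (hζ _).1, MulEquiv.apply_symm_apply]
  · show IsBaseIdentity F₂ (Ψ.functor.map (ζ (ΨN.symm n)))
    exact (isBaseIdentity_map_iff_of_square F₁ F₂ Ψ ΨBase η _).mpr (hζ _).2.1
  · show IsFrobeniusType F₂ (Ψ.functor.map (ζ (ΨN.symm n)))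
    exact (PreFrobenioidData.ofFunctor_isFrobeniusType F₂ _).mp
      (hft _ ((PreFrobenioidData.ofFunctor_isFrobeniusType F₁ _).mpr (hζ _).2.2))

end TwoPreFrobenioids

/-! ### Group-like objects along isomorphisms -/

section GroupLike

variable {D : Type u} [Category.{v} D] {Φ : Dᵒᵖ ⥤ CommMonCat.{w}}
  {C : Type u'} [Category.{v'} C] (F : C ⥤ ElemFrobenioid Φ)

/-- "Group-like" (`Φ(A) = 0`, FrdI Def. 1.2 (iv) p. 23) is invariant under isomorphisms of `C`: pull back
along `Base` of the isomorphism. [cite: MochizukiFrdI2008, Def. 1.2 (iv) p.23] -/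
theorem IsGroupLikeObj.of_iso {A B : C} (e : A ≅ B) (h : IsGroupLikeObj F A) : IsGroupLikeObj F B := by
  intro x
  have h1 : Frobenioids.pull Φ (Base F e.inv) (Frobenioids.pull Φ (Base F e.hom) x) = x := by
    rw [← Frobenioids.pull_comp, ← base_comp, e.inv_hom_id, base_id, Frobenioids.pull_id]
  rw [← h1, h (Frobenioids.pull Φ (Base F e.hom) x), map_one]

end GroupLike

/-! ### Conjugation by `eqToHom` (transport of endomorphisms along an equality of objects) -/

section EqToHomConj

variable {D : Type u} [Category.{v} D] {Φ : Dᵒᵖ ⥤ CommMonCat.{w}}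
  {C : Type u'} [Category.{v'} C] (F : C ⥤ ElemFrobenioid Φ)

/-- Conjugating an endomorphism by `eqToHom` does not change its Frobenius degree.
[cite: MochizukiFrdI2008, Rem. 1.1.1 p.21] -/
theorem degFr_eqToHom_conj {Y B : C} (p : Y = B) (g : Y ⟶ Y) :
    degFr F (eqToHom p.symm ≫ g ≫ eqToHom p) = degFr F g := by
  subst p; simp

/-- Conjugating an endomorphism by `eqToHom` preserves and reflects "base-identity".
[cite: MochizukiFrdI2008, Def. 1.2 (ii) p.22] -/
theorem isBaseIdentity_eqToHom_conj_iff {Y B : C} (p : Y = B) (g : Y ⟶ Y) :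
    IsBaseIdentity F (eqToHom p.symm ≫ g ≫ eqToHom p) ↔ IsBaseIdentity F g := by
  subst p; simp

/-- Conjugating an endomorphism by `eqToHom` preserves and reflects "of Frobenius type".
[cite: MochizukiFrdI2008, Def. 1.2 (iii) p.22] -/
theorem isFrobeniusType_eqToHom_conj_iff {Y B : C} (p : Y = B) (g : Y ⟶ Y) :
    IsFrobeniusType F (eqToHom p.symm ≫ g ≫ eqToHom p) ↔ IsFrobeniusType F g := by
  subst p; simp

end EqToHomConj

end PreFrobenioid

end Literature.AlgebraicGeometry.Frobenioids
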